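import Summits.AnomalousDissipation.AnomalousDissipation.Theorems.ScalarZerothLawKinematicEnergy
import Summits.AnomalousDissipation.AnomalousDissipation.Theorems.ScalarZerothLawKinematicInjection
import Summits.AnomalousDissipation.AnomalousDissipation.Theorems.ScalarZerothLawKinematicDissipation
import HarnessLib

/-!
# Scalar zeroth law over a prescribed carrier — the dissipation floor along a solution

Cell `ad-ideate`, planner ad-ideate-p1 ROUND-10 §B3, Steps 2–5 assembled: for an `L²`-continuous
global weak solution `w` of `∂ₜθ + b·∇θ = κ ∑ᵢ aᵢ ∂ᵢ∂ᵢθ + S` in the charge–discharge setting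
(bounded drift equal to the Hess-Childs–Rowan field `W` on the active units `(nL, nL+1)` and
vanishing on the quiet parts `(nL+1, (n+1)L)`, contraction factor `q` with `2Lq ≤ 1` — hypothesis
`hHCR` —, steady smooth mean-zero source `S`, `κ > 0`, `0 < m ≤ aᵢ ≤ 1`, mean-zero `L²` datum,
`L ≥ 12`, and the diffusivity restriction `κ K L² ‖S‖ ≤ ‖S‖²` with `K ≥ ‖∑ᵢ aᵢ∂ᵢ∂ᵢS‖`):

* `period_injection_ge` — the injection over the shifted period `[1 + nL, 1 + (n+1)L]` is at least
  the floor budget `c` minus a geometrically decaying transient;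
* `le_longTimeAvgInf_dissipation` — **(D)**
  `(L/2 - 5) ‖S‖²_{L²} ≤ liminf_T T⁻¹ ∫₀ᵀ κ ‖∇w(t)‖²_{L²} dt`
  (period injections → running means of the injection, `eventually_le_timeMean_of_period_integrals`;
  dissipation = injection up to `‖w(T)‖²/(2T) → 0`, `integral_source_mul_sub_le_integral_dissipation`;
  the floor budget `floor_budget`).

Supports stmt-AnomalousDissipation-0448 (prescribed-carrier rung; no statement about Navier–Stokes).
-/

noncomputable section

-- `Summit.<Summit>.<Problem>` is the tree's mandated summit-side namespace (CONVENTIONS §2); for this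
-- single-conjunct summit the two coincide, so the duplicate is deliberate.
set_option linter.dupNamespace false

namespace Summit.AnomalousDissipation.AnomalousDissipation.Theorems.ScalarZerothLawKinematic

open MeasureTheory Set Filter Topology
open scoped NNReal ENNReal InnerProductSpace
open Literature.Analysis Literature.Analysis.FluidPDE Literature.Analysis.FunctionSpaces
open Literature.Analysis.FluidPDE.Torus Literature.Analysis.FunctionSpaces.Torus

section Floor

variable {d : Type*} [Fintype d] [DecidableEq d]
  {a : d → ℝ} {κ L A q K m : ℝ} {b W : ℝ → UnitAddTorus d → EuclideanSpace ℝ d}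
  {S θ₀ : UnitAddTorus d → ℝ} {w : ℝ → UnitAddTorus d → ℝ}

omit [DecidableEq d] in
/-- Cauchy–Schwarz in `L²(T^d)` (a private copy of `Torus.DEIJ.abs_integral_mul_le_sqrt`). -/
private theorem abs_integral_mul_le_sqrt_integral_sq {f g : UnitAddTorus d → ℝ} (hf : MemLp f 2 volume)
    (hg : MemLp g 2 volume) :
    |∫ x, f x * g x| ≤ Real.sqrt (∫ x, f x ^ 2) * Real.sqrt (∫ x, g x ^ 2) := by
  have hf' : MemLp f (ENNReal.ofReal 2) volume := by rwa [ENNReal.ofReal_ofNat]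
  have hg' : MemLp g (ENNReal.ofReal 2) volume := by rwa [ENNReal.ofReal_ofNat]
  have h := integral_mul_norm_le_Lp_mul_Lq (μ := volume) Real.HolderConjugate.two_two hf' hg'
  have e2 : ∀ (w : UnitAddTorus d → ℝ), (∫ a, ‖w a‖ ^ (2 : ℝ)) ^ (1 / (2 : ℝ)) = Real.sqrt (∫ a, w a ^ 2) := by
    intro w
    rw [Real.sqrt_eq_rpow]
    congr 1
    refine integral_congr_ae (Eventually.of_forall fun a => ?_)
    dsimp only
    rw [Real.rpow_two, Real.norm_eq_abs, sq_abs]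
  rw [e2, e2] at h
  refine le_trans ?_ h
  calc |∫ x, f x * g x| ≤ ∫ x, |f x * g x| := abs_integral_le_integral_abs
    _ = ∫ x, ‖f x‖ * ‖g x‖ := integral_congr_ae (Eventually.of_forall fun x => by
        simp [abs_mul, Real.norm_eq_abs])

/-- The floor budget under the `σ`-multiplied diffusivity restriction `κ K L² σ ≤ σ²` (which is
automatic for `σ = 0`): either `σ = 0` and both sides vanish, or `κ K L² ≤ σ` and `floor_budget`
applies. -/
theorem floor_budget_of_mul_le {L q σ K κ R : ℝ} (hL : 12 ≤ L) (hq0 : 0 ≤ q) (hq : q * (2 * L) ≤ 1)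
    (hσ : 0 ≤ σ) (hK : 0 ≤ K) (hκ : 0 ≤ κ) (hκK : κ * K * L ^ 2 * σ ≤ σ ^ 2) (hR0 : 0 ≤ R)
    (hR : R * (1 - q) = L * σ) :
    (L ^ 2 / 2 - 5 * L) * σ ^ 2 ≤
      -(L - 1) * (q * R + σ) * σ + (L - 1) ^ 2 / 2 * (σ ^ 2 - κ * K * ((q * R + σ) + (L - 1) * σ)) -
        σ * (R + σ) := by
  rcases hσ.eq_or_lt with hσ0 | hσpos
  · -- `σ = 0`: then `R = 0` and both sides vanish
    have hq1 : q < 1 := by nlinarith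
    have hR' : R = 0 := by
      have : R * (1 - q) = 0 := by rw [hR, ← hσ0, mul_zero]
      rcases mul_eq_zero.1 this with h | h
      · exact h
      · exact absurd h (by linarith)
    rw [← hσ0, hR']
    ring_nf
    rfl
  · have hκK' : κ * K * L ^ 2 ≤ σ := by
      have : κ * K * L ^ 2 * σ ≤ σ * σ := by rw [← sq]; exact hκK
      exact le_of_mul_le_mul_right this hσpos
    exact floor_budget hL hq0 hq hσ hK hκ hκK' hR0 hR

/-- **The injection over one shifted period.** In the charge–discharge setting, for every `n`,
`∫_{1+nL}^{1+(n+1)L} ∫ S w ≥ c - q^{n+1} ‖w(0)‖ D` with the floor budget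
`c = -(L-1)(qR+σ)σ + ½(L-1)²(σ² - κK((qR+σ) + (L-1)σ)) - σ(R+σ)` (`R = Lσ/(1-q)`,
`σ = ‖S‖_{L²}`) and `D = (L-1)σ + ½(L-1)²κK + σ` (quiet-phase and active-unit injection bounds
at the levels `‖w(nL+1)‖ ≤ q(qⁿ‖w(0)‖ + R) + σ`, `‖w((n+1)L)‖ ≤ q^{n+1}‖w(0)‖ + R`). -/
theorem period_injection_ge (hw : IsWeakScalarTransportDiagForced a κ b (fun _ => S) θ₀ w)
    (hwc : IsL2ContinuousOn (Ici 0) w) (hκ : 0 < κ) (ha : ∀ i, 0 < a i) (hθ₀ : MemLp θ₀ 2 volume)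
    (hmean : ∫ x, θ₀ x = 0) (hSmean : ∫ x, S x = 0) (hS : IsSmooth S)
    (hbA : ∀ (t : ℝ) (x : UnitAddTorus d), ‖b t x‖ ≤ A) (hq : 0 ≤ q) (hq1 : q < 1)
    (hHCR : ∀ η₀ : UnitAddTorus d → ℝ, MemLp η₀ 2 volume → ∫ x, η₀ x = 0 →
      ∀ η : ℝ → UnitAddTorus d → ℝ, IsWeakScalarTransportDiagOn 1 a κ W η₀ η →
        IsL2ContinuousOn (Icc 0 1) η → Torus.scalarL2Sq (η 1) ≤ q ^ 2 * Torus.scalarL2Sq η₀)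
    (hbW : ∀ (n : ℕ), ∀ t ∈ Ioo (0 : ℝ) 1, b ((n : ℝ) * L + t) = W t)
    (hb0 : ∀ (n : ℕ) (t : ℝ), (n : ℝ) * L + 1 < t → t < ((n : ℝ) + 1) * L → b t = 0) (hL : 1 < L)
    (hKm : MemLp (fun x => ∑ i, a i * FunctionSpaces.Torus.partialDeriv i (FunctionSpaces.Torus.partialDeriv i S) x)
      2 volume)
    (hK : Real.sqrt (∫ x, (∑ i, a i * FunctionSpaces.Torus.partialDeriv i
      (FunctionSpaces.Torus.partialDeriv i S) x) ^ 2) ≤ K) (n : ℕ) :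
    (-(L - 1) * (q * (L * Real.sqrt (∫ x, S x ^ 2) / (1 - q)) + Real.sqrt (∫ x, S x ^ 2)) *
        Real.sqrt (∫ x, S x ^ 2) +
      (L - 1) ^ 2 / 2 * ((Real.sqrt (∫ x, S x ^ 2)) ^ 2 - κ * K *
        ((q * (L * Real.sqrt (∫ x, S x ^ 2) / (1 - q)) + Real.sqrt (∫ x, S x ^ 2)) +
          (L - 1) * Real.sqrt (∫ x, S x ^ 2))) -
      Real.sqrt (∫ x, S x ^ 2) * (L * Real.sqrt (∫ x, S x ^ 2) / (1 - q) + Real.sqrt (∫ x, S x ^ 2))) -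
      q ^ (n + 1) * Real.sqrt (∫ x, w 0 x ^ 2) *
        ((L - 1) * Real.sqrt (∫ x, S x ^ 2) + (L - 1) ^ 2 / 2 * (κ * K) + Real.sqrt (∫ x, S x ^ 2)) ≤
      ∫ t in (1 + n * L)..(1 + (n + 1) * L), ∫ x, S x * w t x := by
  have hL0 : 0 < L := by linarith
  have hL1 : 1 ≤ L := hL.le
  set σ : ℝ := Real.sqrt (∫ x, S x ^ 2) with hσdef
  have hσ : 0 ≤ σ := Real.sqrt_nonneg _
  have hσ2 : σ ^ 2 = ∫ x, S x ^ 2 := Real.sq_sqrt (integral_nonneg fun x => sq_nonneg _)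
  set R : ℝ := L * σ / (1 - q) with hRdef
  set a0 : ℝ := Real.sqrt (∫ x, w 0 x ^ 2) with ha0def
  have ha0 : 0 ≤ a0 := Real.sqrt_nonneg _
  have hK0 : 0 ≤ K := (Real.sqrt_nonneg _).trans hK
  have hS2 : MemLp S 2 volume := hS.memLp 2
  -- the two levels
  set mN : ℝ := Real.sqrt (∫ x, w ((n : ℝ) * L + 1) x ^ 2) with hmNdef
  set aN : ℝ := Real.sqrt (∫ x, w (((n : ℝ) + 1) * L) x ^ 2) with haNdef
  have hmN : mN ≤ q * (q ^ n * a0 + R) + σ := by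
    have h1 := sqrt_integral_sq_activeEnd_le hw hwc hκ ha hmean hSmean hS hbA hq hHCR (hbW n) hL0.le
    have h2 := periodStart_le hw hwc hκ ha hθ₀ hmean hSmean hS hbA hq hq1 hHCR hbW hL1 n
    have := mul_le_mul_of_nonneg_left h2 hq
    simp only [hmNdef, hσdef, hRdef, ha0def] at h1 h2 this ⊢
    linarith
  have haN : aN ≤ q ^ (n + 1) * a0 + R := by
    have h2 := periodStart_le hw hwc hκ ha hθ₀ hmean hSmean hS hbA hq hq1 hHCR hbW hL1 (n + 1)
    simp only [haNdef, hRdef, ha0def, Nat.cast_add, Nat.cast_one] at h2 ⊢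
    exact h2
  -- the two injection bounds
  have hQ := le_integral_quiet_injection hw hwc hκ ha hθ₀ hS hbA hL hKm hK (n := n) (hb0 n)
  have hAct := le_integral_active_injection hw hwc hκ ha hθ₀ hS2 hbA
    (σ := ((n : ℝ) + 1) * L) (by positivity)
  -- splitting the shifted period at `(n+1)L`
  have hfc : ContinuousOn (fun t => ∫ x, S x * w t x) (Ici 0) :=
    (hwc.continuousOn_integral_mul hS2).congr fun t _ =>
      integral_congr_ae (Eventually.of_forall fun x => mul_comm _ _)
  have hii : ∀ a' b' : ℝ, 0 ≤ a' → 0 ≤ b' → IntervalIntegrable (fun t => ∫ x, S x * w t x) volume a' b' := by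
    intro a' b' ha' hb'
    refine (hfc.mono ?_).intervalIntegrable
    intro t ht
    simp only [mem_Ici]
    rcases le_total a' b' with hab | hab
    · rw [uIcc_of_le hab] at ht; exact ha'.trans ht.1
    · rw [uIcc_of_ge hab] at ht; exact hb'.trans ht.1
  have e1 : ∫ τ in (0 : ℝ)..(L - 1), ∫ x, S x * w ((n : ℝ) * L + 1 + τ) x =
      ∫ t in ((n : ℝ) * L + 1)..(((n : ℝ) + 1) * L), ∫ x, S x * w t x := by
    rw [intervalIntegral.integral_comp_add_left (fun t => ∫ x, S x * w t x) ((n : ℝ) * L + 1)]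
    congr 1 <;> ring
  have e2 : ∫ τ in (0 : ℝ)..1, ∫ x, S x * w (((n : ℝ) + 1) * L + τ) x =
      ∫ t in (((n : ℝ) + 1) * L)..(((n : ℝ) + 1) * L + 1), ∫ x, S x * w t x := by
    rw [intervalIntegral.integral_comp_add_left (fun t => ∫ x, S x * w t x) (((n : ℝ) + 1) * L)]
    simp only [add_zero]
  have hsplit : ∫ t in (1 + n * L)..(1 + (n + 1) * L), ∫ x, S x * w t x =
      (∫ t in ((n : ℝ) * L + 1)..(((n : ℝ) + 1) * L), ∫ x, S x * w t x) +
        ∫ t in (((n : ℝ) + 1) * L)..(((n : ℝ) + 1) * L + 1), ∫ x, S x * w t x := by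
    rw [intervalIntegral.integral_add_adjacent_intervals (hii _ _ (by positivity) (by positivity))
      (hii _ _ (by positivity) (by positivity))]
    congr 1 <;> ring
  rw [hsplit, ← e1, ← e2]
  -- monotonicity in the two levels
  set B0 : ℝ := (L - 1) * σ + (L - 1) ^ 2 / 2 * (κ * K) with hB0def
  have hB0 : 0 ≤ B0 := by
    have : 0 ≤ L - 1 := by linarith
    positivity
  have hQ' : -(L - 1) * mN * σ + (L - 1) ^ 2 / 2 * ((∫ x, S x ^ 2) - κ * K * (mN + (L - 1) * σ)) =
      (L - 1) ^ 2 / 2 * (∫ x, S x ^ 2) - (L - 1) ^ 3 / 2 * (κ * K) * σ - B0 * mN := by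
    rw [hB0def]; ring
  have hmono1 : B0 * mN ≤ B0 * (q * (q ^ n * a0 + R) + σ) := mul_le_mul_of_nonneg_left hmN hB0
  have hmono2 : σ * aN ≤ σ * (q ^ (n + 1) * a0 + R) := mul_le_mul_of_nonneg_left haN hσ
  rw [hQ'] at hQ
  rw [← hσ2] at hQ
  rw [← hσdef, ← haNdef] at hAct
  have epow : q * (q ^ n * a0 + R) = q ^ (n + 1) * a0 + q * R := by rw [pow_succ]; ring
  rw [epow] at hmono1
  have hsum : ((L - 1) ^ 2 / 2 * σ ^ 2 - (L - 1) ^ 3 / 2 * (κ * K) * σ - B0 * mN) + (-(σ * (aN + σ))) ≤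
      (∫ τ in (0 : ℝ)..(L - 1), ∫ x, S x * w ((n : ℝ) * L + 1 + τ) x) +
        ∫ τ in (0 : ℝ)..1, ∫ x, S x * w (((n : ℝ) + 1) * L + τ) x := add_le_add hQ hAct
  have e : -(L - 1) * (q * R + σ) * σ + (L - 1) ^ 2 / 2 * (σ ^ 2 - κ * K * ((q * R + σ) + (L - 1) * σ)) -
      σ * (R + σ) - q ^ (n + 1) * a0 * ((L - 1) * σ + (L - 1) ^ 2 / 2 * (κ * K) + σ) =
      ((L - 1) ^ 2 / 2 * σ ^ 2 - (L - 1) ^ 3 / 2 * (κ * K) * σ - B0 * (q ^ (n + 1) * a0 + q * R + σ)) +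
        (-(σ * (q ^ (n + 1) * a0 + R + σ))) := by
    rw [hB0def]; ring
  rw [e]
  linarith

/-- **(D) The dissipation floor along an `L²`-continuous solution.** In the charge–discharge
setting (module docstring) with `L ≥ 12`, `2Lq ≤ 1`, `0 < m ≤ aᵢ ≤ 1` and `κ K L² ‖S‖ ≤ ‖S‖²`:
`(L/2 - 5) ‖S‖²_{L²} ≤ liminf_T T⁻¹ ∫₀ᵀ κ ‖∇w(t)‖²_{L²} dt`. The injections over the shifted
periods are eventually `≥ c - ε` (`period_injection_ge`), hence the running means of the injection
are eventually `≥ c/L - ε` (`eventually_le_timeMean_of_period_integrals`); the running means of the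
dissipation exceed those of the injection up to `‖w(T)‖²/(2T) → 0`
(`integral_source_mul_sub_le_integral_dissipation`) and are bounded (`integral_dissipation_le`);
and `c ≥ (L²/2 - 5L)‖S‖²` (`floor_budget`). -/
theorem le_longTimeAvgInf_dissipation (hw : IsWeakScalarTransportDiagForced a κ b (fun _ => S) θ₀ w)
    (hwc : IsL2ContinuousOn (Ici 0) w) (hκ : 0 < κ) (ha : ∀ i, 0 < a i) (ha1 : ∀ i, a i ≤ 1)
    (hm : 0 < m) (hma : ∀ i, m ≤ a i) (hθ₀ : MemLp θ₀ 2 volume)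
    (hmean : ∫ x, θ₀ x = 0) (hSmean : ∫ x, S x = 0) (hS : IsSmooth S)
    (hbA : ∀ (t : ℝ) (x : UnitAddTorus d), ‖b t x‖ ≤ A) (hq : 0 ≤ q) (hqL : q * (2 * L) ≤ 1)
    (hHCR : ∀ η₀ : UnitAddTorus d → ℝ, MemLp η₀ 2 volume → ∫ x, η₀ x = 0 →
      ∀ η : ℝ → UnitAddTorus d → ℝ, IsWeakScalarTransportDiagOn 1 a κ W η₀ η →
        IsL2ContinuousOn (Icc 0 1) η → Torus.scalarL2Sq (η 1) ≤ q ^ 2 * Torus.scalarL2Sq η₀)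
    (hbW : ∀ (n : ℕ), ∀ t ∈ Ioo (0 : ℝ) 1, b ((n : ℝ) * L + t) = W t)
    (hb0 : ∀ (n : ℕ) (t : ℝ), (n : ℝ) * L + 1 < t → t < ((n : ℝ) + 1) * L → b t = 0) (hL : 12 ≤ L)
    (hKm : MemLp (fun x => ∑ i, a i * FunctionSpaces.Torus.partialDeriv i (FunctionSpaces.Torus.partialDeriv i S) x)
      2 volume)
    (hK : Real.sqrt (∫ x, (∑ i, a i * FunctionSpaces.Torus.partialDeriv i
      (FunctionSpaces.Torus.partialDeriv i S) x) ^ 2) ≤ K)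
    (hκK : κ * K * L ^ 2 * Real.sqrt (∫ x, S x ^ 2) ≤ Real.sqrt (∫ x, S x ^ 2) ^ 2) (hw0 : w 0 = θ₀) :
    (L / 2 - 5) * Torus.scalarL2Sq S ≤
      longTimeAvgInf (fun t => κ * (Torus.eScalarGradNormSq (w t)).toReal) := by
  have hL0 : 0 < L := by linarith
  have hL1 : 1 < L := by linarith
  have hq24 : q ≤ 1 / 24 := by
    have : q * 24 ≤ q * (2 * L) := mul_le_mul_of_nonneg_left (by linarith) hq
    linarith
  have hq1 : q < 1 := by linarith
  have hS2 : MemLp S 2 volume := hS.memLp 2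
  set σ : ℝ := Real.sqrt (∫ x, S x ^ 2) with hσdef
  have hσ : 0 ≤ σ := Real.sqrt_nonneg _
  have hσ2 : σ ^ 2 = Torus.scalarL2Sq S := Real.sq_sqrt (integral_nonneg fun x => sq_nonneg _)
  set R : ℝ := L * σ / (1 - q) with hRdef
  have h1q : 0 < 1 - q := by linarith
  have hR : R * (1 - q) = L * σ := by rw [hRdef, div_mul_cancel₀ _ h1q.ne']
  have hR0 : 0 ≤ R := by rw [hRdef]; exact div_nonneg (by positivity) h1q.le
  set a0 : ℝ := Real.sqrt (∫ x, w 0 x ^ 2) with ha0def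
  have ha0 : 0 ≤ a0 := Real.sqrt_nonneg _
  have hK0 : 0 ≤ K := (Real.sqrt_nonneg _).trans hK
  -- the floor budget
  set c : ℝ := -(L - 1) * (q * R + σ) * σ + (L - 1) ^ 2 / 2 * (σ ^ 2 - κ * K * ((q * R + σ) + (L - 1) * σ)) -
    σ * (R + σ) with hcdef
  have hc : (L ^ 2 / 2 - 5 * L) * σ ^ 2 ≤ c := floor_budget_of_mul_le hL hq hqL hσ hK0 hκ.le hκK hR0 hR
  set D : ℝ := (L - 1) * σ + (L - 1) ^ 2 / 2 * (κ * K) + σ with hDdef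
  have hD0 : 0 ≤ D := by
    have : 0 ≤ L - 1 := by linarith
    positivity
  -- the injection `f(t) = ∫ S w(t)`: continuous, bounded by `σ B`
  set f : ℝ → ℝ := fun t => ∫ x, S x * w t x with hfdef
  have hfc : ContinuousOn f (Ici 0) :=
    (hwc.continuousOn_integral_mul hS2).congr fun t _ =>
      integral_congr_ae (Eventually.of_forall fun x => mul_comm _ _)
  set B : ℝ := Real.sqrt (∫ x, θ₀ x ^ 2) + 3 * L * σ with hBdef
  have hB0 : 0 ≤ B := by positivity
  have hNB : ∀ t, 0 ≤ t → Real.sqrt (∫ x, w t x ^ 2) ≤ B := fun t ht =>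
    sqrt_integral_sq_le_uniform hw hwc hκ ha hθ₀ hmean hSmean hS hbA hq hqL hHCR hbW hL hw0 ht
  have hfM : ∀ t, 0 ≤ t → |f t| ≤ σ * B := by
    intro t ht
    have hcs := abs_integral_mul_le_sqrt_integral_sq hS2 (hwc.memLp (mem_Ici.2 ht))
    exact hcs.trans (mul_le_mul_of_nonneg_left (hNB t ht) hσ)
  -- the period injections are eventually `≥ c - ε`
  have hP : ∀ ε : ℝ, 0 < ε → ∃ N₀ : ℕ, ∀ n : ℕ, N₀ ≤ n →
      c - ε ≤ ∫ t in (1 + n * L)..(1 + (n + 1) * L), f t := by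
    intro ε hε
    obtain ⟨N₀, hN₀⟩ : ∃ N₀ : ℕ, q ^ (N₀ + 1) * a0 * D ≤ ε := by
      obtain ⟨N₀, hN₀⟩ := exists_pow_lt_of_lt_one (show 0 < ε / (a0 * D + 1) by positivity) hq1
      refine ⟨N₀, ?_⟩
      have h1 : q ^ N₀ * (a0 * D + 1) ≤ ε := ((lt_div_iff₀ (by positivity : 0 < a0 * D + 1)).1 hN₀).le
      have h2 : q ^ (N₀ + 1) ≤ q ^ N₀ := pow_le_pow_of_le_one hq hq1.le (Nat.le_succ N₀)
      nlinarith [pow_nonneg hq (N₀ + 1), pow_nonneg hq N₀, mul_nonneg ha0 hD0]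
    refine ⟨N₀, fun n hn => ?_⟩
    have hper := period_injection_ge hw hwc hκ ha hθ₀ hmean hSmean hS hbA hq hq1 hHCR hbW hb0 hL1 hKm hK n
    have hpow : q ^ (n + 1) * a0 * D ≤ q ^ (N₀ + 1) * a0 * D := by
      have : q ^ (n + 1) ≤ q ^ (N₀ + 1) := pow_le_pow_of_le_one hq hq1.le (by omega)
      exact mul_le_mul_of_nonneg_right (mul_le_mul_of_nonneg_right this ha0) hD0
    rw [← hσdef, ← ha0def] at hper
    rw [← hRdef] at hper
    rw [← hcdef, ← hDdef] at hper
    linarith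
  have hev := fun ε (hε : 0 < ε) =>
    eventually_le_timeMean_of_period_integrals (c := c) hfc hfM zero_le_one hL0 hP hε
  -- running means of the dissipation versus those of the injection
  have hlow : ∀ ε : ℝ, 0 < ε → ∀ᶠ T in atTop,
      c / L - ε ≤ timeMean (fun t => κ * (Torus.eScalarGradNormSq (w t)).toReal) T := by
    intro ε hε
    have h1 := hev (ε / 2) (half_pos hε)
    have h2 : ∀ᶠ T : ℝ in atTop, B ^ 2 / 2 * T⁻¹ ≤ ε / 2 := by
      have h0 : Tendsto (fun T : ℝ => B ^ 2 / 2 * T⁻¹) atTop (𝓝 (B ^ 2 / 2 * 0)) :=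
        tendsto_inv_atTop_zero.const_mul _
      rw [mul_zero] at h0
      exact h0.eventually (eventually_le_nhds (half_pos hε))
    filter_upwards [h1, h2, eventually_gt_atTop (0 : ℝ)] with T hT1 hT2 hT0
    have hdis := integral_source_mul_sub_le_integral_dissipation hw hwc hκ ha ha1 hθ₀ hbA hS2 hT0.le
    have eI : ∫ τ in Ioo 0 T, ∫ x, S x * w τ x = ∫ τ in (0 : ℝ)..T, f τ := by
      rw [intervalIntegral.integral_of_le hT0.le, setIntegral_congr_set (Ioo_ae_eq_Ioc (μ := (volume : Measure ℝ)))]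
    have hNT : ∫ x, w T x ^ 2 ≤ B ^ 2 := by
      have h := hNB T hT0.le
      have e : ∫ x, w T x ^ 2 = Real.sqrt (∫ x, w T x ^ 2) ^ 2 :=
        (Real.sq_sqrt (integral_nonneg fun x => sq_nonneg _)).symm
      rw [e]
      exact pow_le_pow_left₀ (Real.sqrt_nonneg _) h 2
    rw [eI] at hdis
    have hTinv : 0 < T⁻¹ := inv_pos.2 hT0
    have key : T⁻¹ * ((∫ τ in (0 : ℝ)..T, f τ) - B ^ 2 / 2) ≤
        T⁻¹ * ∫ τ in (0 : ℝ)..T, κ * (Torus.eScalarGradNormSq (w τ)).toReal :=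
      mul_le_mul_of_nonneg_left (by linarith) hTinv.le
    rw [timeMean] at hT1 ⊢
    have e2 : T⁻¹ * ((∫ τ in (0 : ℝ)..T, f τ) - B ^ 2 / 2) =
        T⁻¹ * (∫ τ in (0 : ℝ)..T, f τ) - B ^ 2 / 2 * T⁻¹ := by ring
    rw [e2] at key
    linarith
  have hup : ∀ᶠ T in atTop, timeMean (fun t => κ * (Torus.eScalarGradNormSq (w t)).toReal) T ≤
      m⁻¹ * ((∫ x, θ₀ x ^ 2) / 2 + σ * B) := by
    filter_upwards [eventually_ge_atTop (1 : ℝ)] with T hT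
    have hT0 : 0 < T := by linarith
    have hdis2 := integral_dissipation_le hw hwc hκ ha hθ₀ hbA hS2 hm hma (T := T) hT0.le
    have eI : ∫ τ in Ioo 0 T, ∫ x, S x * w τ x = ∫ τ in (0 : ℝ)..T, f τ := by
      rw [intervalIntegral.integral_of_le hT0.le, setIntegral_congr_set (Ioo_ae_eq_Ioc (μ := (volume : Measure ℝ)))]
    have hIf : ∫ τ in (0 : ℝ)..T, f τ ≤ σ * B * T := by
      have h := intervalIntegral.norm_integral_le_of_norm_le_const (a := (0 : ℝ)) (b := T) (C := σ * B)
        (f := f) fun t ht => by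
          rw [uIoc_of_le hT0.le] at ht
          rw [Real.norm_eq_abs]
          exact hfM t ht.1.le
      rw [Real.norm_eq_abs, sub_zero, abs_of_pos hT0] at h
      exact (le_abs_self _).trans h
    rw [eI] at hdis2
    rw [timeMean]
    have hTinv : 0 < T⁻¹ := inv_pos.2 hT0
    have h3 : T⁻¹ * ∫ τ in (0 : ℝ)..T, κ * (Torus.eScalarGradNormSq (w τ)).toReal ≤
        T⁻¹ * (m⁻¹ * ((∫ x, θ₀ x ^ 2) / 2 + σ * B * T)) := by
      refine mul_le_mul_of_nonneg_left (hdis2.trans ?_) hTinv.le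
      exact mul_le_mul_of_nonneg_left (by linarith) (inv_nonneg.2 hm.le)
    have h4 : T⁻¹ * (m⁻¹ * ((∫ x, θ₀ x ^ 2) / 2 + σ * B * T)) ≤ m⁻¹ * ((∫ x, θ₀ x ^ 2) / 2 + σ * B) := by
      have hθ : 0 ≤ ∫ x, θ₀ x ^ 2 := integral_nonneg fun x => sq_nonneg _
      have hT1' : T⁻¹ ≤ 1 := inv_le_one_of_one_le₀ hT
      have hTne : T ≠ 0 := hT0.ne'
      have e : T⁻¹ * (m⁻¹ * ((∫ x, θ₀ x ^ 2) / 2 + σ * B * T)) =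
          m⁻¹ * (T⁻¹ * ((∫ x, θ₀ x ^ 2) / 2) + σ * B) := by
        have : T⁻¹ * (σ * B * T) = σ * B := by field_simp
        rw [mul_left_comm, mul_add, this]
      rw [e]
      refine mul_le_mul_of_nonneg_left ?_ (inv_nonneg.2 hm.le)
      have h5 : T⁻¹ * ((∫ x, θ₀ x ^ 2) / 2) ≤ (∫ x, θ₀ x ^ 2) / 2 :=
        mul_le_of_le_one_left (by positivity) hT1'
      linarith
    exact h3.trans h4
  have key := le_longTimeAvgInf_of_forall_pos_eventually_le hup hlow
  calc (L / 2 - 5) * Torus.scalarL2Sq S = (L ^ 2 / 2 - 5 * L) * σ ^ 2 / L := by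
        rw [hσ2]; field_simp
    _ ≤ c / L := div_le_div_of_nonneg_right hc hL0.le
    _ ≤ _ := key

end Floor

end Summit.AnomalousDissipation.AnomalousDissipation.Theorems.ScalarZerothLawKinematic

end
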